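/-
[OURS · L1 W4.5(b) · EL♮(3)] SPECIMEN-TC⁺ (quartic) — the chart `Spec (k[X]/(f)) → Γ = V(closure T)_red` over an ambient chart, generic in `f`.
-/
import Summits.ResolutionOfSingularities.ResolutionOfSingularities.Theorems.EquisingularLiftEquisingularLiftNatSpecimenQuarticTcPlusHypersurfacePoint
import Summits.ResolutionOfSingularities.ResolutionOfSingularities.Theorems.EquisingularLiftEquisingularLiftNatSpecimenQuarticTcDeltaGammaChart
import HarnessLib

/-!
# [OURS · L1 W4.5(b) · EL♮(3)] SPECIMEN-TC⁺ for the quartic — part G: THE CHART `Spec (k[X]/(f)) → Γ = V(closure T)_red` OVER AN AMBIENT CHART,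
# GENERIC in the equation `f ∈ 𝔪₀`
# (crux `EquisingularLiftNatThree` = stmt-ResolutionOfSingularities-20148; res-L1-w45b-lead-2 DEALS (D2) 2026-08-27T11:55:26Z «NON-VACUITY
# CERTIFICATES TC⁺»; scoping memo D/res-D-pv-034/SPECIMEN-TCPLUS-SCOPE.md §5; helper, closes nothing)

HONEST FRAMING. OURS (cell `res-hironaka`, chain w45b, slot W4.5(b)); NOT a statement of any manuscript; AI-written, weaker than expert review.

This is `…SpecimenQuarticTcDeltaGammaChart` (p526994, written for `f = z² + x⁴ + y⁴`) with the equation made a parameter: for an open-immersion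
chart `w : Spec k[X] → Y` with `𝓘_T · 𝒪 = (f)~` (`T` closed, `f ∈ 𝔪₀`), the affine piece of `Γ = V(closure T)_red` over `U = w(Spec k[X])` is
`Spec (Γ(Y,U)/𝓘(U)) ≅ Spec (k[X]/(f))`; `gammaChartF : Spec (k[X]/(f)) → Γ` is that open immersion, with range `Γι⁻¹ U`, seeing the point `x₀`
of `Γ` over `w(o)` exactly at the origin `ptF` (`preimage_gammaChartF_singleton`), pulling the trace `𝓘_{w(o)} · 𝒪_Γ` back to `𝔪̄₀~`
(`comap_gammaChartF_trace_singleton`), and pulling a closed `Z ⊆ Y` with `𝓘_Z · 𝒪 = J~` on the chart back to `V(J̄)` (`preimage_gammaChartF_eq_zeroLocus`).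
Consumer: the inner step of the TC⁺ certificate (`f = gL`).

References: Stacks 01R8, 080E; Hartshorne II Ex. 3.2.6 (via the cited tree files).
-/

set_option linter.dupNamespace false -- mandated namespace `Summit.<Summit>.<Problem>` of this single-conjunct summit

noncomputable section

open CategoryTheory CategoryTheory.Limits AlgebraicGeometry TopologicalSpace
open MvPolynomial
open AlgebraicGeometry.Scheme.IdealSheafData
open Literature.AlgebraicGeometry.Resolution
open Summit.ResolutionOfSingularities.ResolutionOfSingularities.Theorems.EquisingularLift

namespace Summit.ResolutionOfSingularities.ResolutionOfSingularities.Cruxes.EquisingularLiftNat.Sections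

namespace SpecimenQuarticTcPlus

open SpecimenQuarticTcDelta

section GammaChartF

variable {k : Type} [Field k]
variable {Y : Scheme.{0}} (w : Spec (CommRingCat.of (MvPolynomial (Fin 3) k)) ⟶ Y) [IsOpenImmersion w]
variable {T : Set Y} (hTc : IsClosed T) (f : MvPolynomial (Fin 3) k)
variable (hwT : (vanishingIdeal (⟨T, hTc⟩ : Closeds Y)).comap w =
    ofIdealTop ((Ideal.span {f}).map (Scheme.ΓSpecIso (CommRingCat.of (MvPolynomial (Fin 3) k))).inv.hom))

/-! ## Membership in a closed set read through the ideal of sections -/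

omit [IsOpenImmersion w] in
/-- **Membership in a closed `Z` read on an affine open**: `fromSpec r ∈ Z ↔ 𝓘_Z(U) ≤ r`. [cite: Hartshorne1977, II Example 3.2.6] -/
theorem fromSpec_mem_iff_ideal_le (U : Y.affineOpens) {Z : Set Y} (hZc : IsClosed Z) (r : Spec Γ(Y, U)) :
    U.2.fromSpec r ∈ Z ↔ (vanishingIdeal (⟨Z, hZc⟩ : Closeds Y)).ideal U ≤ r.asIdeal := by
  have hcl : IsClosed (U.2.fromSpec ⁻¹' Z) := hZc.preimage U.2.fromSpec.continuous
  have hideal : (vanishingIdeal (⟨Z, hZc⟩ : Closeds Y)).ideal U = PrimeSpectrum.vanishingIdeal (U.2.fromSpec ⁻¹' Z) := by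
    rw [vanishingIdeal_ideal]; rfl
  rw [hideal]
  set S : Set (Spec Γ(Y, U)) := U.2.fromSpec ⁻¹' Z with hS
  change r ∈ S ↔ _
  constructor
  · intro hr
    have h1 : r ∈ PrimeSpectrum.zeroLocus (PrimeSpectrum.vanishingIdeal S : Set Γ(Y, U)) := by
      rw [PrimeSpectrum.zeroLocus_vanishingIdeal_eq_closure]; exact subset_closure hr
    exact fun a ha => (PrimeSpectrum.mem_zeroLocus _ _).mp h1 ha
  · intro h
    have h1 : r ∈ PrimeSpectrum.zeroLocus (PrimeSpectrum.vanishingIdeal S : Set Γ(Y, U)) :=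
      (PrimeSpectrum.mem_zeroLocus _ _).mpr (fun a ha => h ha)
    rw [PrimeSpectrum.zeroLocus_vanishingIdeal_eq_closure] at h1
    exact hcl.closure_subset h1

/-! ## The chart `Spec (k[X]/(f)) → Γ` -/

omit [IsOpenImmersion w] in
include hwT in
/-- `𝓘_{closure T}` also pulls back to `(f)~`. [folklore] -/
theorem comap_vanishingIdeal_closure_eqF :
    (vanishingIdeal (⟨closure T, isClosed_closure⟩ : Closeds Y)).comap w =
    ofIdealTop ((Ideal.span {f}).map (Scheme.ΓSpecIso (CommRingCat.of (MvPolynomial (Fin 3) k))).inv.hom) := by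
  have hcl : (⟨closure T, isClosed_closure⟩ : Closeds Y) = ⟨T, hTc⟩ := Closeds.ext hTc.closure_eq
  rw [hcl, hwT]

/-- **`Γ(Y, U)/𝓘_{closure T}(U) ≅ k[X]/(f)`** on the chart `U = w(Spec k[X])`. [folklore] -/
def sectionsQuotEquivF (hwT : (vanishingIdeal (⟨T, hTc⟩ : Closeds Y)).comap w =
    ofIdealTop ((Ideal.span {f}).map (Scheme.ΓSpecIso (CommRingCat.of (MvPolynomial (Fin 3) k))).inv.hom)) :
    (Γ(Y, (chartOpen w : Y.Opens)) ⧸ (vanishingIdeal (⟨closure T, isClosed_closure⟩ : Closeds Y)).ideal (chartOpen w)) ≃+* Df k f :=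
  Ideal.quotientEquiv _ _ (chartRingEquiv w)
    (map_ideal_chartOpen_eq w _ _ (comap_vanishingIdeal_closure_eqF w hTc f hwT)).symm

/-- `Spec (k[X]/(f)) ≅ Spec (Γ(Y,U)/𝓘(U))`. [folklore] -/
def specIsoDF (hwT : (vanishingIdeal (⟨T, hTc⟩ : Closeds Y)).comap w =
    ofIdealTop ((Ideal.span {f}).map (Scheme.ΓSpecIso (CommRingCat.of (MvPolynomial (Fin 3) k))).inv.hom)) :
    Spec (CommRingCat.of (Df k f)) ≅ Spec (CommRingCat.of (Γ(Y, (chartOpen w : Y.Opens)) ⧸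
      (vanishingIdeal (⟨closure T, isClosed_closure⟩ : Closeds Y)).ideal (chartOpen w))) :=
  Scheme.Spec.mapIso (sectionsQuotEquivF w hTc f hwT).toCommRingCatIso.op

/-- **The chart of `Γ = V(closure T)_red` over `w(Spec k[X])`**: `Spec (k[X]/(f)) ≅ Spec (Γ(Y,U)/𝓘(U)) → Γ`. [cite: StacksProject, Tag 01R8] -/
def gammaChartF (hwT : (vanishingIdeal (⟨T, hTc⟩ : Closeds Y)).comap w =
    ofIdealTop ((Ideal.span {f}).map (Scheme.ΓSpecIso (CommRingCat.of (MvPolynomial (Fin 3) k))).inv.hom)) :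
    Spec (CommRingCat.of (Df k f)) ⟶ (vanishingIdeal (⟨closure T, isClosed_closure⟩ : Closeds Y)).subscheme :=
  (specIsoDF w hTc f hwT).hom ≫ (vanishingIdeal (⟨closure T, isClosed_closure⟩ : Closeds Y)).subschemeCover.f (chartOpen w)

/-- The chart of `Γ` is an open immersion. [folklore] -/
instance isOpenImmersion_gammaChartF (hwT : (vanishingIdeal (⟨T, hTc⟩ : Closeds Y)).comap w =
    ofIdealTop ((Ideal.span {f}).map (Scheme.ΓSpecIso (CommRingCat.of (MvPolynomial (Fin 3) k))).inv.hom)) :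
    IsOpenImmersion (gammaChartF w hTc f hwT) :=
  @IsOpenImmersion.comp _ _ _ (specIsoDF w hTc f hwT).hom _ inferInstance
    ((vanishingIdeal (⟨closure T, isClosed_closure⟩ : Closeds Y)).subschemeCover.map_prop (chartOpen w))

/-- `gammaChartF ≫ Γι = Spec(quotient ∘ iso) ≫ U.fromSpec`. [folklore] -/
theorem gammaChartF_comp_subschemeι :
    gammaChartF w hTc f hwT ≫ (vanishingIdeal (⟨closure T, isClosed_closure⟩ : Closeds Y)).subschemeι =
      (specIsoDF w hTc f hwT).hom ≫ Spec.map (CommRingCat.ofHom (Ideal.Quotient.mk _)) ≫ (chartOpen w).2.fromSpec := by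
  rw [gammaChartF, Category.assoc]
  erw [subschemeCover_map_subschemeι, glueDataObjι_ι]

/-- The range of the chart of `Γ` is `Γι⁻¹(w(Spec k[X]))`. [folklore] -/
theorem range_gammaChartF :
    Set.range (gammaChartF w hTc f hwT) =
      (vanishingIdeal (⟨closure T, isClosed_closure⟩ : Closeds Y)).subschemeι ⁻¹' Set.range w := by
  have hsurj : Function.Surjective (specIsoDF w hTc f hwT).hom := (Scheme.homeoOfIso (specIsoDF w hTc f hwT)).surjective
  have h1 : Set.range (gammaChartF w hTc f hwT) =
      Set.range ((vanishingIdeal (⟨closure T, isClosed_closure⟩ : Closeds Y)).subschemeCover.f (chartOpen w)) := by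
    rw [gammaChartF]
    change Set.range (fun q => (vanishingIdeal (⟨closure T, isClosed_closure⟩ : Closeds Y)).subschemeCover.f (chartOpen w)
      ((specIsoDF w hTc f hwT).hom q)) = _
    exact hsurj.range_comp _
  rw [h1, ← Scheme.Hom.coe_opensRange, opensRange_subschemeCover_map]
  change (vanishingIdeal (⟨closure T, isClosed_closure⟩ : Closeds Y)).subschemeι ⁻¹' ((chartOpen w : Y.Opens) : Set Y) = _
  congr 1
  change ((w ''ᵁ ⊤ : Y.Opens) : Set Y) = Set.range w
  rw [Scheme.Hom.image_top_eq_opensRange]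
  rfl

/-- A point of `Γ` over the chart is in the range of `gammaChartF`. [folklore] -/
theorem mem_range_gammaChartF {x : (vanishingIdeal (⟨closure T, isClosed_closure⟩ : Closeds Y)).subscheme}
    (hx : (vanishingIdeal (⟨closure T, isClosed_closure⟩ : Closeds Y)).subschemeι x ∈ Set.range w) :
    x ∈ Set.range (gammaChartF w hTc f hwT) := by
  rw [range_gammaChartF]; exact hx

/-- The composite ring map `Γ(Y,U) → Γ(Y,U)/𝓘(U) ≅ k[X]/(f)` is `mk_f ∘ e_w`. [folklore] -/
theorem sectionsQuotEquivF_comp_mk :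
    (sectionsQuotEquivF w hTc f hwT).toRingHom.comp
      (Ideal.Quotient.mk ((vanishingIdeal (⟨closure T, isClosed_closure⟩ : Closeds Y)).ideal (chartOpen w))) =
      (Ideal.Quotient.mk (Ideal.span {f})).comp (chartRingEquiv w).toRingHom :=
  RingHom.ext fun _ => rfl

/-- **The chart of `Γ` followed by `Γι`, pointwise**: the point `gammaChartF q` of `Γ` lies over `U.fromSpec` of the prime
`(mk_f ∘ e_w)⁻¹ q`. [folklore] -/
theorem subschemeι_gammaChartF_apply (q : Spec (CommRingCat.of (Df k f))) :
    (vanishingIdeal (⟨closure T, isClosed_closure⟩ : Closeds Y)).subschemeι (gammaChartF w hTc f hwT q) =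
      (chartOpen w).2.fromSpec ⟨q.asIdeal.comap ((Ideal.Quotient.mk (Ideal.span {f})).comp (chartRingEquiv w).toRingHom),
        inferInstance⟩ := by
  rw [← Scheme.Hom.comp_apply, gammaChartF_comp_subschemeι, Scheme.Hom.comp_apply, Scheme.Hom.comp_apply]
  congr 1

variable {f} (hf : f ∈ PointBlowup.originIdeal 2 k)

/-- **The preimage of a closed `Z ⊆ Y` under the chart of `Γ`**: if `𝓘_Z · 𝒪 = J~` on the ambient chart `w`, then
`(gammaChartF ≫ Γι)⁻¹ Z = V(J̄)`, `J̄ = J · (k[X]/(f))`. [cite: Hartshorne1977, II Example 3.2.6] -/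
theorem preimage_gammaChartF_eq_zeroLocus {Z : Set Y} (hZc : IsClosed Z) (J : Ideal (MvPolynomial (Fin 3) k))
    (hwZ : (vanishingIdeal (⟨Z, hZc⟩ : Closeds Y)).comap w =
      ofIdealTop (J.map (Scheme.ΓSpecIso (CommRingCat.of (MvPolynomial (Fin 3) k))).inv.hom)) :
    gammaChartF w hTc f hwT ⁻¹' ((vanishingIdeal (⟨closure T, isClosed_closure⟩ : Closeds Y)).subschemeι ⁻¹' Z) =
      PrimeSpectrum.zeroLocus ((J.map (Ideal.Quotient.mk (Ideal.span {f})) : Ideal (Df k f)) : Set (Df k f)) := by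
  have hJ : (vanishingIdeal (⟨Z, hZc⟩ : Closeds Y)).ideal (chartOpen w) = J.map (chartRingEquiv w).symm.toRingHom := by
    have h := map_ideal_chartOpen_eq w _ _ hwZ
    have h2 := congrArg (Ideal.map (chartRingEquiv w).symm.toRingHom) h
    rw [Ideal.map_map] at h2
    have hid : (chartRingEquiv w).symm.toRingHom.comp (chartRingEquiv w).toRingHom = RingHom.id _ :=
      RingHom.ext fun a => (chartRingEquiv w).symm_apply_apply a
    rw [hid, Ideal.map_id] at h2
    exact h2
  ext q
  rw [Set.mem_preimage, Set.mem_preimage, subschemeι_gammaChartF_apply, fromSpec_mem_iff_ideal_le _ hZc, hJ]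
  change J.map (chartRingEquiv w).symm.toRingHom ≤
      q.asIdeal.comap ((Ideal.Quotient.mk (Ideal.span {f})).comp (chartRingEquiv w).toRingHom) ↔ _
  have hid : ((Ideal.Quotient.mk (Ideal.span {f})).comp (chartRingEquiv w).toRingHom).comp (chartRingEquiv w).symm.toRingHom =
      Ideal.Quotient.mk (Ideal.span {f}) :=
    RingHom.ext fun a => by simp
  rw [Ideal.map_le_iff_le_comap, Ideal.comap_comap, hid, ← Ideal.map_le_iff_le_comap]
  exact (PrimeSpectrum.mem_zeroLocus _ _).symm

/-- The preimage of the centre `{w(o)}` under the chart of `Γ` is the origin. [folklore] -/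
theorem preimage_gammaChartF_singleton' (hc : IsClosed ({w (o k)} : Set Y)) :
    gammaChartF w hTc f hwT ⁻¹' ((vanishingIdeal (⟨closure T, isClosed_closure⟩ : Closeds Y)).subschemeι ⁻¹' {w (o k)}) = {ptF k hf} := by
  rw [preimage_gammaChartF_eq_zeroLocus w hTc hwT hc (PointBlowup.originIdeal 2 k) (comap_vanishingIdeal_singleton_chart w hc),
    singleton_ptF_eq_zeroLocus]

/-- **The chart of `Γ` sees the point `x₀` over `w(o)` only at the origin**: `gammaChartF⁻¹{x₀} = {pt}`. [folklore] -/
theorem preimage_gammaChartF_singleton (hc : IsClosed ({w (o k)} : Set Y))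
    {x₀ : (vanishingIdeal (⟨closure T, isClosed_closure⟩ : Closeds Y)).subscheme}
    (hx₀ : (vanishingIdeal (⟨closure T, isClosed_closure⟩ : Closeds Y)).subschemeι x₀ = w (o k)) :
    gammaChartF w hTc f hwT ⁻¹' {x₀} = {ptF k hf} := by
  have hinj := (vanishingIdeal (⟨closure T, isClosed_closure⟩ : Closeds Y)).subschemeι.isClosedEmbedding.injective
  have h : ({x₀} : Set (vanishingIdeal (⟨closure T, isClosed_closure⟩ : Closeds Y)).subscheme) =
      (vanishingIdeal (⟨closure T, isClosed_closure⟩ : Closeds Y)).subschemeι ⁻¹' {w (o k)} := by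
    ext x
    simp only [Set.mem_singleton_iff, Set.mem_preimage]
    rw [← hx₀]
    exact (hinj.eq_iff).symm
  rw [h]
  exact preimage_gammaChartF_singleton' w hTc hwT hf hc

/-- The point of `Γ` over `w(o)` is `gammaChartF pt`. [folklore] -/
theorem gammaChartF_ptF (hc : IsClosed ({w (o k)} : Set Y))
    {x₀ : (vanishingIdeal (⟨closure T, isClosed_closure⟩ : Closeds Y)).subscheme}
    (hx₀ : (vanishingIdeal (⟨closure T, isClosed_closure⟩ : Closeds Y)).subschemeι x₀ = w (o k)) :
    gammaChartF w hTc f hwT (ptF k hf) = x₀ := by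
  have h : ptF k hf ∈ gammaChartF w hTc f hwT ⁻¹' {x₀} := by
    rw [preimage_gammaChartF_singleton w hTc hwT hf hc hx₀]; exact Set.mem_singleton _
  exact h

include hf in
/-- **The trace of `𝓘_{w(o)}` on `Γ`, pulled back to `Spec (k[X]/(f))`, is `𝔪̄₀~`.** [folklore] -/
theorem comap_gammaChartF_trace_singleton (hc : IsClosed ({w (o k)} : Set Y))
    {x₀ : (vanishingIdeal (⟨closure T, isClosed_closure⟩ : Closeds Y)).subscheme}
    (hx₀ : (vanishingIdeal (⟨closure T, isClosed_closure⟩ : Closeds Y)).subschemeι x₀ = w (o k)) :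
    ((vanishingIdeal (⟨{w (o k)}, hc⟩ : Closeds Y)).comap
        (vanishingIdeal (⟨closure T, isClosed_closure⟩ : Closeds Y)).subschemeι).comap (gammaChartF w hTc f hwT) =
      ofIdealTop ((mbarF k f).map (Scheme.ΓSpecIso (CommRingCat.of (Df k f))).inv.hom) := by
  rw [comap_subschemeι_vanishingIdeal_singleton w hc hx₀, comap_vanishingIdeal_of_isOpenImmersion]
  have h : (Closeds.preimage (⟨{x₀}, isClosed_singleton_of_subschemeι_eq w hc hx₀⟩ :
      Closeds (vanishingIdeal (⟨closure T, isClosed_closure⟩ : Closeds Y)).subscheme) (gammaChartF w hTc f hwT).continuous) =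
      ⟨{ptF k hf}, isClosed_ptF k hf⟩ := Closeds.ext (preimage_gammaChartF_singleton w hTc hwT hf hc hx₀)
  rw [h, vanishingIdeal_singleton_ptF]

end GammaChartF

end SpecimenQuarticTcPlus

end Summit.ResolutionOfSingularities.ResolutionOfSingularities.Cruxes.EquisingularLiftNat.Sections
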